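import Summits.Ventures.PercRepro.RankLevelSetLevelElevenInfraGXT

/-!
# PercRepro — THE LEVEL-`12` INFRASTRUCTURE OF THE GXT CHAIN: the flat bound `f(12) ≤ 2559`, the intersection cap
`ν_∩ ≤ 1268`, the `Icc 3 13` sum, `C(m + 12, 12)·12!`, the tail doubling step and the mid-sum split at level `12`
(p2, gen 36; a feeder for S4 — the top of the `q = 12` window, from `2,768`)

Every statement is the level-`12` instance of a level-`11` statement of the tree (RankLevelSetLevelElevenInfraGXT), proved the
same way; the truncated-tail lemmas of RankLevelSetLevelElevenInfraGXT are generic in `n` and are reused as they are.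
* `ncard_le_twenty_five_fifty_nine_of_eRk_le_twelve_of_free` — `f(12) ≤ 2559 = 2·1279 + 1`;
* `hinter_twelve` — every rank-`≤ 11` set of the `e`-free core has `≤ r(X) + min 1268 d` points (`1279 = 11 + 1268`);
* `sum_Icc_three_thirteen_q`, `Explicit.choose_twelve_mul` (`12!·C(m + 12, 12) = (m + 1)⋯(m + 12)`);
* `mul_tailG_twelve_le_of_base` — the level-`12` tail `G₁₂` from a base, any constants (every term at most doubles);
* `sum_Ico_choose_add_sum_range_choose_le_twelve`.
Axioms: standard.
-/

set_option exponentiation.threshold 8192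

open scoped Matroid

namespace PercRepro

namespace ThmN

open Set

variable {α : Type}

/-- `Σ_{k ∈ Icc 3 13} g k` written out. -/
theorem sum_Icc_three_thirteen_q (g : ℕ → ℚ) :
    ∑ k ∈ Finset.Icc 3 13, g k = g 3 + g 4 + g 5 + g 6 + g 7 + g 8 + g 9 + g 10 + g 11 + g 12 + g 13 := by
  rw [show (13 : ℕ) = 12 + 1 from rfl, Finset.sum_Icc_succ_top (by norm_num), sum_Icc_three_twelve_q]

/-- `12!·C(m + 12, 12) = (m + 1)(m + 2)⋯(m + 12)` (from `Explicit.choose_eleven_mul` by `C(n, 12)·12 = C(n, 11)·(n − 11)`). -/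
theorem Explicit.choose_twelve_mul (m : ℕ) :
    479001600 * (m + 12).choose 12 =
      (m + 1) * (m + 2) * (m + 3) * (m + 4) * (m + 5) * (m + 6) * (m + 7) * (m + 8) * (m + 9) * (m + 10) * (m + 11) * (m + 12) := by
  have h1 : (m + 12).choose 12 * 12 = (m + 12).choose 11 * (m + 1) := by
    have := Nat.choose_succ_right_eq (m + 12) 11
    rwa [show m + 12 - 11 = m + 1 by omega] at this
  have h2 : 39916800 * (m + 12).choose 11 =
      (m + 2) * (m + 3) * (m + 4) * (m + 5) * (m + 6) * (m + 7) * (m + 8) * (m + 9) * (m + 10) * (m + 11) * (m + 12) := by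
    have := Explicit.choose_eleven_mul (m + 1)
    rw [show m + 1 + 11 = m + 12 by ring] at this
    rw [this]
  calc 479001600 * (m + 12).choose 12 = 39916800 * ((m + 12).choose 12 * 12) := by ring
    _ = 39916800 * ((m + 12).choose 11 * (m + 1)) := by rw [h1]
    _ = (39916800 * (m + 12).choose 11) * (m + 1) := by ring
    _ = ((m + 2) * (m + 3) * (m + 4) * (m + 5) * (m + 6) * (m + 7) * (m + 8) * (m + 9) * (m + 10) * (m + 11) * (m + 12)) * (m + 1) := by
        rw [h2]
    _ = (m + 1) * (m + 2) * (m + 3) * (m + 4) * (m + 5) * (m + 6) * (m + 7) * (m + 8) * (m + 9) * (m + 10) * (m + 11) * (m + 12) := by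
        ring

/-- `f(12) ≤ 2559` on the `e`-free core (`2559 = 2·1279 + 1`). -/
theorem ncard_le_twenty_five_fifty_nine_of_eRk_le_twelve_of_free (M : Matroid α) [M.Finite]
    (hfree : ∀ e ∈ M.E, ∃ A ⊆ M.E \ {e}, e ∉ M.closure A ∧ e ∉ M.closure ((M.E \ {e}) \ A)) :
    ∀ X ⊆ M.E, M.eRk X ≤ 12 → X.ncard ≤ 2559 := by
  intro X hX hr
  have := ncard_le_two_mul_add_one_of_free M hfree (k := 11) (B := 1279)
    (fun _ hY hrY => ncard_le_twelve_seventy_nine_of_eRk_le_eleven_of_free M hfree _ hY (by exact_mod_cast hrY)) X hX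
    (by exact_mod_cast hr)
  omega

/-- **The intersection cap at level `12`**: every rank-`≤ 11` subset of the `e`-free core of corank `d` has at most
`r(X) + min 1268 d` points (the flat bounds `1 / 3 / … / 639 / 1279` and the nullity cap). -/
theorem hinter_twelve (M : Matroid α) [M.Finite] {d : ℕ} (hd : M.E.encard = M.eRank + d)
    (hfree : ∀ e ∈ M.E, ∃ A ⊆ M.E \ {e}, e ∉ M.closure A ∧ e ∉ M.closure ((M.E \ {e}) \ A)) :
    ∀ X ⊆ M.E, M.eRk X ≤ ((12 - 1 : ℕ) : ℕ∞) → (X.ncard : ℕ∞) ≤ M.eRk X + (min 1268 d : ℕ) := by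
  intro X hX hr
  obtain ⟨k, hk⟩ := Matroid.exists_eRk_eq_nat (M := M) hX
  rw [hk] at hr ⊢
  have hk11 : k ≤ 11 := by exact_mod_cast hr
  have hcap : X.ncard ≤ k + d := by
    have h1 := Matroid.encard_le_eRk_add_of_encard_eq hX hd
    rw [hk] at h1
    have hfin : X.Finite := M.ground_finite.subset hX
    rw [← hfin.cast_ncard_eq] at h1
    exact_mod_cast h1
  have h1268 : X.ncard ≤ k + 1268 := by
    rcases Nat.lt_or_ge k 11 with h | h
    · have h10 : M.eRk X ≤ ((11 - 1 : ℕ) : ℕ∞) := by rw [hk]; exact_mod_cast (by omega : k ≤ 11 - 1)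
      have := hinter_eleven M hd hfree X hX h10
      rw [hk] at this
      have h629 : X.ncard ≤ k + min 629 d := by exact_mod_cast this
      omega
    · have hk' : k = 11 := by omega
      subst hk'
      have := ncard_le_twelve_seventy_nine_of_eRk_le_eleven_of_free M hfree X hX (le_of_eq hk)
      omega
  have hcard : X.ncard ≤ k + min 1268 d := by omega
  exact_mod_cast hcard

/-- **The level-`12` tail from a base, any constants**: `a·G₁₂(d, n₀) ≤ b·2^n₀` with `24 ≤ n₀` gives `a·G₁₂(d, n) ≤ b·2^n` for
every `n ≥ n₀` (every term of `G₁₂` at most doubles from `n` to `n + 1`). -/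
theorem mul_tailG_twelve_le_of_base (a b d n₀ : ℕ) (h24 : 24 ≤ n₀)
    (h : a * (n₀.choose 12 * 2 ^ (min 2547 d) + n₀.choose 11 * 2 ^ 1268 + n₀.choose 10 * 2 ^ 629 + n₀.choose 9 * 2 ^ 310 + n₀.choose 8 * 2 ^ 151 +
      n₀.choose 7 * 2 ^ 72 + n₀.choose 6 * 2 ^ 33 + n₀.choose 5 * 2 ^ 14 + n₀.choose 4 * 2 ^ 6 + n₀.choose 3 * 2 ^ 3 +
      n₀.choose 2 * 2 + n₀ + 1 + ∑ j ∈ Finset.range (d + 1), n₀.choose j) ≤ b * 2 ^ n₀)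
    (n : ℕ) (hn : n₀ ≤ n) :
    a * (n.choose 12 * 2 ^ (min 2547 d) + n.choose 11 * 2 ^ 1268 + n.choose 10 * 2 ^ 629 + n.choose 9 * 2 ^ 310 + n.choose 8 * 2 ^ 151 +
      n.choose 7 * 2 ^ 72 + n.choose 6 * 2 ^ 33 + n.choose 5 * 2 ^ 14 + n.choose 4 * 2 ^ 6 + n.choose 3 * 2 ^ 3 +
      n.choose 2 * 2 + n + 1 + ∑ j ∈ Finset.range (d + 1), n.choose j) ≤ b * 2 ^ n := by
  induction n, hn using Nat.le_induction with
  | base => exact h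
  | succ n hn ih =>
    have h12 := choose_succ_le_two_mul_of_two_mul_le_cube n 12 (by omega)
    have h11 := choose_succ_le_two_mul_of_two_mul_le_cube n 11 (by omega)
    have h10 := choose_succ_le_two_mul_of_two_mul_le_cube n 10 (by omega)
    have h9 := choose_succ_le_two_mul_of_two_mul_le_cube n 9 (by omega)
    have h8 := choose_succ_le_two_mul_of_two_mul_le_cube n 8 (by omega)
    have h7 := choose_succ_le_two_mul_of_two_mul_le_cube n 7 (by omega)
    have h6 := choose_succ_le_two_mul_of_two_mul_le_cube n 6 (by omega)
    have h5 := choose_succ_le_two_mul_of_two_mul_le_cube n 5 (by omega)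
    have h4 := choose_succ_le_two_mul_of_two_mul_le_cube n 4 (by omega)
    have h3 := choose_succ_le_two_mul_of_two_mul_le_cube n 3 (by omega)
    have h2 := choose_succ_le_two_mul_of_two_mul_le_cube n 2 (by omega)
    have hS := PercRepro.sum_choose_succ_le_two_mul n d
    have hpow : 2 ^ (n + 1) = 2 * 2 ^ n := by ring
    have hG : (n + 1).choose 12 * 2 ^ (min 2547 d) + (n + 1).choose 11 * 2 ^ 1268 + (n + 1).choose 10 * 2 ^ 629 + (n + 1).choose 9 * 2 ^ 310 +
        (n + 1).choose 8 * 2 ^ 151 + (n + 1).choose 7 * 2 ^ 72 + (n + 1).choose 6 * 2 ^ 33 + (n + 1).choose 5 * 2 ^ 14 +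
        (n + 1).choose 4 * 2 ^ 6 + (n + 1).choose 3 * 2 ^ 3 + (n + 1).choose 2 * 2 + (n + 1) + 1 +
        ∑ j ∈ Finset.range (d + 1), (n + 1).choose j ≤
        2 * (n.choose 12 * 2 ^ (min 2547 d) + n.choose 11 * 2 ^ 1268 + n.choose 10 * 2 ^ 629 + n.choose 9 * 2 ^ 310 + n.choose 8 * 2 ^ 151 +
          n.choose 7 * 2 ^ 72 + n.choose 6 * 2 ^ 33 + n.choose 5 * 2 ^ 14 + n.choose 4 * 2 ^ 6 + n.choose 3 * 2 ^ 3 +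
          n.choose 2 * 2 + n + 1 + ∑ j ∈ Finset.range (d + 1), n.choose j) := by
      have m12 := Nat.mul_le_mul_right (2 ^ (min 2547 d)) h12
      have m11 := Nat.mul_le_mul_right (2 ^ 1268) h11
      have m10 := Nat.mul_le_mul_right (2 ^ 629) h10
      have m9 := Nat.mul_le_mul_right (2 ^ 310) h9
      have m8 := Nat.mul_le_mul_right (2 ^ 151) h8
      have m7 := Nat.mul_le_mul_right (2 ^ 72) h7
      have m6 := Nat.mul_le_mul_right (2 ^ 33) h6
      have m5 := Nat.mul_le_mul_right (2 ^ 14) h5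
      have m4 := Nat.mul_le_mul_right (2 ^ 6) h4
      have m3 := Nat.mul_le_mul_right (2 ^ 3) h3
      have m2 := Nat.mul_le_mul_right 2 h2
      rw [mul_assoc] at m12 m11 m10 m9 m8 m7 m6 m5 m4 m3 m2
      linarith
    calc a * ((n + 1).choose 12 * 2 ^ (min 2547 d) + (n + 1).choose 11 * 2 ^ 1268 + (n + 1).choose 10 * 2 ^ 629 + (n + 1).choose 9 * 2 ^ 310 +
          (n + 1).choose 8 * 2 ^ 151 + (n + 1).choose 7 * 2 ^ 72 + (n + 1).choose 6 * 2 ^ 33 + (n + 1).choose 5 * 2 ^ 14 +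
          (n + 1).choose 4 * 2 ^ 6 + (n + 1).choose 3 * 2 ^ 3 + (n + 1).choose 2 * 2 + (n + 1) + 1 +
          ∑ j ∈ Finset.range (d + 1), (n + 1).choose j)
        ≤ a * (2 * (n.choose 12 * 2 ^ (min 2547 d) + n.choose 11 * 2 ^ 1268 + n.choose 10 * 2 ^ 629 + n.choose 9 * 2 ^ 310 + n.choose 8 * 2 ^ 151 +
          n.choose 7 * 2 ^ 72 + n.choose 6 * 2 ^ 33 + n.choose 5 * 2 ^ 14 + n.choose 4 * 2 ^ 6 + n.choose 3 * 2 ^ 3 +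
          n.choose 2 * 2 + n + 1 + ∑ j ∈ Finset.range (d + 1), n.choose j)) := Nat.mul_le_mul_left _ hG
      _ = 2 * (a * (n.choose 12 * 2 ^ (min 2547 d) + n.choose 11 * 2 ^ 1268 + n.choose 10 * 2 ^ 629 + n.choose 9 * 2 ^ 310 + n.choose 8 * 2 ^ 151 +
          n.choose 7 * 2 ^ 72 + n.choose 6 * 2 ^ 33 + n.choose 5 * 2 ^ 14 + n.choose 4 * 2 ^ 6 + n.choose 3 * 2 ^ 3 +
          n.choose 2 * 2 + n + 1 + ∑ j ∈ Finset.range (d + 1), n.choose j)) := by ring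
      _ ≤ 2 * (b * 2 ^ n) := Nat.mul_le_mul_left _ ih
      _ = b * 2 ^ (n + 1) := by rw [hpow]; ring

/-- `Σ_{k ∈ Ico 12 p} C(n, k) + Σ_{j ≤ d} C(n, j) ≤ 2^n` for `n = p + d`. -/
theorem sum_Ico_choose_add_sum_range_choose_le_twelve (p d : ℕ) :
    ∑ k ∈ Finset.Ico 12 p, (p + d).choose k + ∑ j ∈ Finset.range (d + 1), (p + d).choose j ≤ 2 ^ (p + d) := by
  have h1 : ∑ k ∈ Finset.Ico 12 p, (p + d).choose k ≤ ∑ k ∈ Finset.Ico 11 p, (p + d).choose k :=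
    Finset.sum_le_sum_of_subset (Finset.Ico_subset_Ico_left (by omega))
  have := sum_Ico_choose_add_sum_range_choose_le_eleven p d
  omega

end ThmN

end PercRepro
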